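import Mathlib.GroupTheory.Index
import Mathlib.Algebra.BigOperators.Group.Finset.Basic
import Mathlib.Data.Fintype.BigOperators
import Mathlib.Algebra.Group.Submonoid.BigOperators
import Mathlib.Algebra.Group.TypeTags.Hom
import Summits.BirchSwinnertonDyer.BirchSwinnertonDyer.Theorems.PrintCf2RubinValueTwoLeopoldtUnitsLocalDevissage
import HarnessLib

/-!
# Orbit descent for the local atom (FILE C, algebraic half): covers modulo `p·A + (γ₁−1)A + (γ₂−1)A` are stable under
# the group generated by `γ₁, γ₂`, assemble over blocks, descend along orbits, and yield the subgroup `P` of `hP`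

Cell `bsd-print-cf2`, width seat `bsd-line-cf2-p1-w8` g8, `--supports` the DECIDING class crux
`PrintCf2RubinValueTwo.MainConjClauseAtSplitTwoQuadDAClass` (stmt-BirchSwinnertonDyer-23300; skeleton `m_line_pin_class` v3.x,
stub `stub_localAtom` / (U1) f.g. half) as a helper. THEOREMS ONLY (no `def`, no named fact, no `sorry`); Mathlib + one helper
file. HONEST FRAMING: pure algebra; nothing here closes the crux or a stub; no summit statement is proved; BSD is not proved.

WHY. After this seat's `…LeopoldtUnitsFGLayerBound` (p743314) and cf2c-w5 g11's `…LeopoldtUnitsFGOfLayerBound` (p744633) the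
f.g. atom `Finite ((semilocalUnitData₂ hG hN).M ⧸ 𝔪•⊤)` is, BY NAME, the per-level bound
`hP : ∀ n, ∃ P ≤ U(F_n), P.FiniteIndex ∧ P.index ≤ B ∧ ∀ u ∈ P, ∃ a b d, u = a^p·(γ₁b·b⁻¹)·(γ₂d·d⁻¹)`
(`LeopoldtAtV.isFG_semilocalUnitData₂_of_level_bound`), and cf2c-w5 g11's local devissage (`LeopoldtAtV.exists_cover_of_devissage`,
p744096, fed by `…LocalCyclicInputs`, p744375) produces, PER PLACE `w`, a finite cover of the local units modulo
`p·a + (σc − c) + (τd − d)` with `σ, τ` generating the decomposition group `D_w ≤ ⟨γ̄₁, γ̄₂⟩`. This file is the algebra in between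
(FILE C of the split recorded on the cell STATUS, 2026-08-29T20:41Z / 21:2xZ): how per-place covers become the per-level `P`.

WHAT (for a commutative group `U` — multiplicatively — or `A` — additively — with two endomorphisms `γ₁, γ₂`; «relation» = an
element `a^p·(γ₁b·b⁻¹)·(γ₂d·d⁻¹)`, resp. `p•a + (γ₁b − b) + (γ₂d − d)`):
* §1 (additive) closure: `rel_zero/add/neg/sub/sum/nsmul`, ★ `rel_pow_pow_sub` — `(γ₁^i γ₂^j) u − u` is a relation (telescoping),
  so the local relations `(σc − c)`, `(τd − d)` with `σ, τ ∈ ⟨γ₁, γ₂⟩` (abelian, so `= γ₁^iγ₂^j`) are global relations;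
* §2 (additive) ★ `exists_addSubgroup_of_cover` (finite cover ⟹ subgroup of relations of finite index ≤ #cover),
  ★ `exists_cover_of_blocks` (`A = ∑_o N_o`, covers of the blocks of sizes `#S_o` ⟹ cover of `A` of size `∏ #S_o`),
  ★ `cover_block_of_transport` (a block `∑_{x∈O} M_x` whose pieces are relations away from one `M_{x₀}` — an ORBIT — is covered
  by a cover of `M_{x₀}` alone: the number of places above `v` in `F_n` does not enter, only the number of orbits = places of
  `K₀ = F_n^{⟨γ̄₁,γ̄₂⟩}` above `v`);
* §3 (multiplicative, the currency of `hP`) `finiteIndex_and_index_le_of_mul_cover`, ★ `exists_subgroup_of_cover` and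
  ★★ `exists_subgroup_of_block_covers` (conclusions VERBATIM in the shape of `hP`), `exists_subgroup_rel`,
  `rel_iterate_iterate_mul_inv` (iterates `γ₁^[i] ∘ γ₂^[j]`; NB `γ ^ i` in `U →* U` is the pointwise power),
  ★ `mul_cover_block_of_transport`, and the additive ↔ multiplicative dictionary `mul_cover_of_additive_cover`
  (`Additive U`, `γᵢ′ = MonoidHom.toAdditive γᵢ`, the currency of `exists_cover_of_devissage`).

WHAT IS LEFT of FILE C after this (recorded for the next seat; not done here): (C-β) `D ≤ ⟨γ̄₁,γ̄₂⟩` abelian ⟹ `D = ⟨σ, τ⟩` for some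
`σ, τ`; (C-γ) the dictionary `↥(Semilocal.principalUnits K v (F n))`, `galTranslateU` ≅ blocks `M_w` (units supported at one place
`w ∣ v`) permuted by `⟨γ₁,γ₂⟩` (ty2 `Semilocal.unitsEquiv`, Childress-road `SemiLocal.smul_apply_smul`); (C-δ) the local covers of the
`M_w` from `exists_cover_of_devissage` + `…LocalCyclicInputs` + ty2's power-class index.

References: K. Rubin, Invent. Math. 103 (1991) §4 p. 36–37 [Rubin1991]; J.-P. Serre, *Local Fields* VII §5 (Shapiro), XIII §4
[SerreLocalFields1979]; D. Harari, *Galois Cohomology and Class Field Theory* §13.1 [Harari2020].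
-/

set_option linter.dupNamespace false
set_option autoImplicit false

open Finset

namespace Summit.BirchSwinnertonDyer.BirchSwinnertonDyer.Theorems.PrintCf2.UnitsFGLayerBound

/-! ### §1. The relation module `p·A + (γ₁−1)A + (γ₂−1)A` in element form: closure properties -/

section Additive

variable {A : Type*} [AddCommGroup A] (p : ℕ) (γ₁ γ₂ : AddMonoid.End A)

/-- `0` is of the form `p•a + (γ₁b − b) + (γ₂d − d)`. [folklore] -/
theorem rel_zero : ∃ a b d : A, (0 : A) = p • a + (γ₁ b - b) + (γ₂ d - d) :=
  ⟨0, 0, 0, by simp⟩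

/-- Sums of elements of the form `p•a + (γ₁b − b) + (γ₂d − d)` are of that form. [folklore] -/
theorem rel_add {x y : A} (hx : ∃ a b d : A, x = p • a + (γ₁ b - b) + (γ₂ d - d))
    (hy : ∃ a b d : A, y = p • a + (γ₁ b - b) + (γ₂ d - d)) :
    ∃ a b d : A, x + y = p • a + (γ₁ b - b) + (γ₂ d - d) := by
  obtain ⟨a, b, d, rfl⟩ := hx
  obtain ⟨a', b', d', rfl⟩ := hy
  exact ⟨a + a', b + b', d + d', by simp only [smul_add, map_add]; abel⟩

/-- Negatives of elements of the form `p•a + (γ₁b − b) + (γ₂d − d)` are of that form. [folklore] -/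
theorem rel_neg {x : A} (hx : ∃ a b d : A, x = p • a + (γ₁ b - b) + (γ₂ d - d)) :
    ∃ a b d : A, -x = p • a + (γ₁ b - b) + (γ₂ d - d) := by
  obtain ⟨a, b, d, rfl⟩ := hx
  exact ⟨-a, -b, -d, by simp only [smul_neg, map_neg]; abel⟩

/-- Differences of elements of the form `p•a + (γ₁b − b) + (γ₂d − d)` are of that form. [folklore] -/
theorem rel_sub {x y : A} (hx : ∃ a b d : A, x = p • a + (γ₁ b - b) + (γ₂ d - d))
    (hy : ∃ a b d : A, y = p • a + (γ₁ b - b) + (γ₂ d - d)) :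
    ∃ a b d : A, x - y = p • a + (γ₁ b - b) + (γ₂ d - d) := by
  rw [sub_eq_add_neg]; exact rel_add p γ₁ γ₂ hx (rel_neg p γ₁ γ₂ hy)

/-- Finite sums of elements of the form `p•a + (γ₁b − b) + (γ₂d − d)` are of that form. [folklore] -/
theorem rel_sum {ι : Type*} (s : Finset ι) (f : ι → A)
    (hf : ∀ i ∈ s, ∃ a b d : A, f i = p • a + (γ₁ b - b) + (γ₂ d - d)) :
    ∃ a b d : A, ∑ i ∈ s, f i = p • a + (γ₁ b - b) + (γ₂ d - d) := by
  classical
  induction s using Finset.induction_on with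
  | empty => rw [Finset.sum_empty]; exact rel_zero p γ₁ γ₂
  | insert i s hi ih =>
    rw [Finset.sum_insert hi]
    exact rel_add p γ₁ γ₂ (hf i (Finset.mem_insert_self i s)) (ih fun j hj ↦ hf j (Finset.mem_insert_of_mem hj))

/-- `p•a` is of the form. [folklore] -/
theorem rel_nsmul (a : A) : ∃ a' b d : A, p • a = p • a' + (γ₁ b - b) + (γ₂ d - d) := ⟨a, 0, 0, by simp⟩

/-- `γ₁b − b` is of the form. [folklore] -/
theorem rel_sub_left (b : A) : ∃ a b' d : A, γ₁ b - b = p • a + (γ₁ b' - b') + (γ₂ d - d) := ⟨0, b, 0, by simp⟩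

/-- `γ₂d − d` is of the form. [folklore] -/
theorem rel_sub_right (d : A) : ∃ a b d' : A, γ₂ d - d = p • a + (γ₁ b - b) + (γ₂ d' - d') := ⟨0, 0, d, by simp⟩

/-- **Telescoping**: `γ₁^i u − u` is of the form `p•a + (γ₁b − b) + (γ₂d − d)`. [folklore] -/
theorem rel_pow_left_sub (i : ℕ) (u : A) : ∃ a b d : A, (γ₁ ^ i) u - u = p • a + (γ₁ b - b) + (γ₂ d - d) := by
  induction i with
  | zero => rw [pow_zero, AddMonoid.End.coe_one, id_eq, sub_self]; exact rel_zero p γ₁ γ₂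
  | succ i ih =>
    have e : (γ₁ ^ (i + 1)) u - u = (γ₁ ((γ₁ ^ i) u) - (γ₁ ^ i) u) + ((γ₁ ^ i) u - u) := by
      rw [pow_succ', AddMonoid.End.coe_mul, Function.comp_apply]; abel
    rw [e]
    exact rel_add p γ₁ γ₂ (rel_sub_left p γ₁ γ₂ _) ih

/-- **Telescoping**: `γ₂^j u − u` is of the form. [folklore] -/
theorem rel_pow_right_sub (j : ℕ) (u : A) : ∃ a b d : A, (γ₂ ^ j) u - u = p • a + (γ₁ b - b) + (γ₂ d - d) := by
  induction j with
  | zero => rw [pow_zero, AddMonoid.End.coe_one, id_eq, sub_self]; exact rel_zero p γ₁ γ₂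
  | succ j ih =>
    have e : (γ₂ ^ (j + 1)) u - u = (γ₂ ((γ₂ ^ j) u) - (γ₂ ^ j) u) + ((γ₂ ^ j) u - u) := by
      rw [pow_succ', AddMonoid.End.coe_mul, Function.comp_apply]; abel
    rw [e]
    exact rel_add p γ₁ γ₂ (rel_sub_right p γ₁ γ₂ _) ih

/-- **Every element `h = γ₁^i γ₂^j` of the (abelian) group generated by `γ₁, γ₂` acts trivially modulo the relation module**:
`(γ₁^i γ₂^j) u − u` is of the form `p•a + (γ₁b − b) + (γ₂d − d)` — so the per-place relations `(σc − c)`, `(τd − d)` of the local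
devissage with `σ, τ ∈ ⟨γ₁, γ₂⟩` are global relations. [folklore] -/
theorem rel_pow_pow_sub (i j : ℕ) (u : A) : ∃ a b d : A, (γ₁ ^ i * γ₂ ^ j) u - u = p • a + (γ₁ b - b) + (γ₂ d - d) := by
  have e : (γ₁ ^ i * γ₂ ^ j) u - u = ((γ₁ ^ i) ((γ₂ ^ j) u) - (γ₂ ^ j) u) + ((γ₂ ^ j) u - u) := by
    rw [AddMonoid.End.coe_mul, Function.comp_apply]; abel
  rw [e]
  exact rel_add p γ₁ γ₂ (rel_pow_left_sub p γ₁ γ₂ i _) (rel_pow_right_sub p γ₁ γ₂ j u)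

/-! ### §2. Covers: from a finite cover modulo the relations to a subgroup of bounded index -/

/-- **A finite cover modulo the relations gives the subgroup of `hP`**: if every `a ∈ A` is congruent to some `s ∈ S` modulo
an element `p•a' + (γ₁b − b) + (γ₂d − d)`, then there is a subgroup `P ≤ A` of finite index `≤ #S` all of whose elements are of that
form (namely the relation module itself). [folklore] -/
theorem exists_addSubgroup_of_cover (S : Finset A)
    (hS : ∀ x, ∃ s ∈ S, ∃ a b d : A, x - s = p • a + (γ₁ b - b) + (γ₂ d - d)) :
    ∃ P : AddSubgroup A, P.FiniteIndex ∧ P.index ≤ S.card ∧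
      ∀ x ∈ P, ∃ a b d : A, x = p • a + (γ₁ b - b) + (γ₂ d - d) := by
  let P : AddSubgroup A :=
    { carrier := {x | ∃ a b d : A, x = p • a + (γ₁ b - b) + (γ₂ d - d)}
      zero_mem' := rel_zero p γ₁ γ₂
      add_mem' := fun hx hy ↦ rel_add p γ₁ γ₂ hx hy
      neg_mem' := fun hx ↦ rel_neg p γ₁ γ₂ hx }
  obtain ⟨hfin, hidx⟩ := LeopoldtAtV.finiteIndex_and_index_le_of_cover P S fun x ↦
    (hS x).elim fun s hs ↦ ⟨s, hs.1, hs.2⟩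
  exact ⟨P, hfin, hidx, fun x hx ↦ hx⟩

/-- **Covers assemble over blocks.** If `A` is generated by finitely many subgroups `N o` (every element is a sum `∑_o f o`,
`f o ∈ N o`) and each `N o` is covered modulo the relations by a finite set `S o`, then `A` is covered by a set of size
`≤ ∏_o #(S o)` (the sums of one element from each `S o`). [folklore] -/
theorem exists_cover_of_blocks {O : Type*} [Fintype O] [DecidableEq A] (N : O → AddSubgroup A)
    (hgen : ∀ x : A, ∃ f : O → A, (∀ o, f o ∈ N o) ∧ x = ∑ o, f o) (S : O → Finset A)
    (hS : ∀ o, ∀ n ∈ N o, ∃ s ∈ S o, ∃ a b d : A, n - s = p • a + (γ₁ b - b) + (γ₂ d - d)) :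
    ∃ T : Finset A, T.card ≤ ∏ o, (S o).card ∧
      ∀ x, ∃ t ∈ T, ∃ a b d : A, x - t = p • a + (γ₁ b - b) + (γ₂ d - d) := by
  classical
  refine ⟨(Fintype.piFinset S).image fun g ↦ ∑ o, g o,
    Finset.card_image_le.trans (Fintype.card_piFinset S).le, fun x ↦ ?_⟩
  obtain ⟨f, hf, rfl⟩ := hgen x
  choose g hgS hg using fun o ↦ hS o (f o) (hf o)
  refine ⟨∑ o, g o, Finset.mem_image.2 ⟨g, Fintype.mem_piFinset.2 hgS, rfl⟩, ?_⟩
  rw [← Finset.sum_sub_distrib]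
  exact rel_sum p γ₁ γ₂ _ _ fun o _ ↦ hg o

/-- **Orbit transport.** A block generated by subgroups `M x`, `x ∈ O` (every element a sum `∑_{x∈O} f x`, `f x ∈ M x`), in which
every `m ∈ M x` is congruent modulo the relations to an element of one fixed `M x₀` (in the application: `m = h•m₀`, `h ∈ ⟨γ₁,γ₂⟩`,
and `h•m₀ − m₀` is a relation by `rel_pow_pow_sub`), is covered by any cover of `M x₀`. [folklore] -/
theorem cover_block_of_transport {X : Type*} (O : Finset X) (M : X → AddSubgroup A) (x₀ : X)
    (htr : ∀ x ∈ O, ∀ m ∈ M x, ∃ m₀ ∈ M x₀, ∃ a b d : A, m - m₀ = p • a + (γ₁ b - b) + (γ₂ d - d))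
    (S₀ : Finset A) (hS₀ : ∀ m ∈ M x₀, ∃ s ∈ S₀, ∃ a b d : A, m - s = p • a + (γ₁ b - b) + (γ₂ d - d))
    (n : A) (hn : ∃ f : X → A, (∀ x ∈ O, f x ∈ M x) ∧ n = ∑ x ∈ O, f x) :
    ∃ s ∈ S₀, ∃ a b d : A, n - s = p • a + (γ₁ b - b) + (γ₂ d - d) := by
  classical
  obtain ⟨f, hf, rfl⟩ := hn
  have hch : ∀ x, ∃ m₀ : A, x ∈ O → m₀ ∈ M x₀ ∧ ∃ a b d : A, f x - m₀ = p • a + (γ₁ b - b) + (γ₂ d - d) := by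
    intro x
    by_cases hx : x ∈ O
    · obtain ⟨m₀, hm₀, hrel⟩ := htr x hx (f x) (hf x hx)
      exact ⟨m₀, fun _ ↦ ⟨hm₀, hrel⟩⟩
    · exact ⟨0, fun h ↦ (hx h).elim⟩
  choose g hg using hch
  have hsum : ∑ x ∈ O, g x ∈ M x₀ := sum_mem fun x hx ↦ (hg x hx).1
  obtain ⟨s, hs, hrel⟩ := hS₀ _ hsum
  refine ⟨s, hs, ?_⟩
  have e : ∑ x ∈ O, f x - s = ∑ x ∈ O, (f x - g x) + (∑ x ∈ O, g x - s) := by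
    rw [Finset.sum_sub_distrib]; abel
  rw [e]
  exact rel_add p γ₁ γ₂ (rel_sum p γ₁ γ₂ _ _ fun x hx ↦ (hg x hx).2) hrel

end Additive

/-! ### §3. The multiplicative form consumed by `hP` -/

section Multiplicative

variable {U : Type*} [CommGroup U] (p : ℕ) (γ₁ γ₂ : U →* U)

/-- **Covering ⟹ index** (multiplicative form of `LeopoldtAtV.finiteIndex_and_index_le_of_cover`). [folklore] -/
theorem finiteIndex_and_index_le_of_mul_cover (P : Subgroup U) (S : Finset U) (hS : ∀ u, ∃ s ∈ S, u * s⁻¹ ∈ P) :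
    P.FiniteIndex ∧ P.index ≤ S.card := by
  classical
  have hsurj : Function.Surjective (fun s : S ↦ (QuotientGroup.mk (s : U) : U ⧸ P)) := by
    intro q
    obtain ⟨u, rfl⟩ := QuotientGroup.mk_surjective q
    obtain ⟨s, hs, hus⟩ := hS u
    refine ⟨⟨s, hs⟩, ?_⟩
    rw [QuotientGroup.eq]
    have e : (s : U)⁻¹ * u = u * s⁻¹ := mul_comm _ _
    rw [e]; exact hus
  haveI : Finite (U ⧸ P) := Finite.of_surjective _ hsurj
  refine ⟨Subgroup.finiteIndex_of_finite_quotient, ?_⟩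
  rw [Subgroup.index, ← Nat.card_eq_finsetCard]
  exact Nat.card_le_card_of_surjective _ hsurj

/-- **The subgroup `P` of `hP` from a finite cover** (multiplicative form, VERBATIM the shape of the hypothesis of
`LeopoldtAtV.isFG_semilocalUnitData₂_of_level_bound`): if every `u ∈ U` satisfies `u · s⁻¹ = a^p · (γ₁b·b⁻¹) · (γ₂d·d⁻¹)` for
some `s` in a finite set `S`, then there is `P ≤ U` of finite index `≤ #S` all of whose elements are of that form (namely the
subgroup OF the elements of that form). [folklore] -/
theorem exists_subgroup_of_cover (S : Finset U)
    (hS : ∀ u, ∃ s ∈ S, ∃ a b d : U, u * s⁻¹ = a ^ p * (γ₁ b * b⁻¹) * (γ₂ d * d⁻¹)) :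
    ∃ P : Subgroup U, P.FiniteIndex ∧ P.index ≤ S.card ∧
      ∀ u ∈ P, ∃ a b d : U, u = a ^ p * (γ₁ b * b⁻¹) * (γ₂ d * d⁻¹) := by
  let P : Subgroup U :=
    { carrier := {u | ∃ a b d : U, u = a ^ p * (γ₁ b * b⁻¹) * (γ₂ d * d⁻¹)}
      one_mem' := ⟨1, 1, 1, by simp⟩
      mul_mem' := by
        rintro x y ⟨a, b, d, rfl⟩ ⟨a', b', d', rfl⟩
        refine ⟨a * a', b * b', d * d', ?_⟩
        simp only [map_mul, mul_pow, mul_inv]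
        ac_rfl
      inv_mem' := by
        rintro x ⟨a, b, d, rfl⟩
        refine ⟨a⁻¹, b⁻¹, d⁻¹, ?_⟩
        simp only [map_inv, mul_inv, inv_pow, inv_inv] }
  obtain ⟨hfin, hidx⟩ := finiteIndex_and_index_le_of_mul_cover P S fun u ↦
    (hS u).elim fun s hs ↦ ⟨s, hs.1, hs.2⟩
  exact ⟨P, hfin, hidx, fun u hu ↦ hu⟩

/-- **Additive ⟹ multiplicative dictionary** for covers: a cover of `Additive U` modulo
`p·a + (γ₁′b − b) + (γ₂′d − d)` (`γᵢ′ = MonoidHom.toAdditive γᵢ`, the currency of the local devissage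
`LeopoldtAtV.exists_cover_of_devissage`) is a cover of `U` modulo `a^p · (γ₁b·b⁻¹) · (γ₂d·d⁻¹)`. [folklore] -/
theorem mul_cover_of_additive_cover (S : Finset U)
    (hS : ∀ x : Additive U, ∃ s ∈ S, ∃ a b d : Additive U, x - Additive.ofMul s =
      p • a + ((MonoidHom.toAdditive γ₁ : AddMonoid.End (Additive U)) b - b) +
        ((MonoidHom.toAdditive γ₂ : AddMonoid.End (Additive U)) d - d)) :
    ∀ u, ∃ s ∈ S, ∃ a b d : U, u * s⁻¹ = a ^ p * (γ₁ b * b⁻¹) * (γ₂ d * d⁻¹) := by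
  intro u
  obtain ⟨s, hs, a, b, d, h⟩ := hS (Additive.ofMul u)
  refine ⟨s, hs, Additive.toMul a, Additive.toMul b, Additive.toMul d, ?_⟩
  have h' := congrArg Additive.toMul h
  rw [toMul_sub, toMul_ofMul, toMul_ofMul, div_eq_mul_inv] at h'
  rw [h', toMul_add, toMul_add, toMul_sub, toMul_sub, toMul_nsmul, div_eq_mul_inv, div_eq_mul_inv]
  rfl

/-- **The relation subgroup** `{a^p · (γ₁b·b⁻¹) · (γ₂d·d⁻¹)}` of a commutative group with two endomorphisms exists as a
`Subgroup` (closure under products and inverses by commutativity). [folklore] -/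
theorem exists_subgroup_rel : ∃ P : Subgroup U, ∀ u, u ∈ P ↔ ∃ a b d : U, u = a ^ p * (γ₁ b * b⁻¹) * (γ₂ d * d⁻¹) :=
  ⟨{ carrier := {u | ∃ a b d : U, u = a ^ p * (γ₁ b * b⁻¹) * (γ₂ d * d⁻¹)}
     one_mem' := ⟨1, 1, 1, by simp⟩
     mul_mem' := by
       rintro x y ⟨a, b, d, rfl⟩ ⟨a', b', d', rfl⟩
       refine ⟨a * a', b * b', d * d', ?_⟩
       simp only [map_mul, mul_pow, mul_inv]
       ac_rfl
     inv_mem' := by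
       rintro x ⟨a, b, d, rfl⟩
       refine ⟨a⁻¹, b⁻¹, d⁻¹, ?_⟩
       simp only [map_inv, mul_inv, inv_pow, inv_inv] }, fun _ ↦ Iff.rfl⟩

/-- **`γ₁^[i] (γ₂^[j] u) · u⁻¹` is a relation** (multiplicative form of `rel_pow_pow_sub`, with ITERATES — beware that `γ ^ i` in
`U →* U` is the pointwise power): every element of the abelian group of endomorphisms generated by `γ₁, γ₂` acts trivially modulo
the relation subgroup. [folklore] -/
theorem rel_iterate_iterate_mul_inv (i j : ℕ) (u : U) :
    ∃ a b d : U, (⇑γ₁)^[i] ((⇑γ₂)^[j] u) * u⁻¹ = a ^ p * (γ₁ b * b⁻¹) * (γ₂ d * d⁻¹) := by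
  let δ₁ : AddMonoid.End (Additive U) := MonoidHom.toAdditive γ₁
  let δ₂ : AddMonoid.End (Additive U) := MonoidHom.toAdditive γ₂
  obtain ⟨a, b, d, h⟩ := rel_pow_pow_sub p δ₁ δ₂ i j (Additive.ofMul u)
  refine ⟨Additive.toMul a, Additive.toMul b, Additive.toMul d, ?_⟩
  rw [AddMonoid.End.coe_mul, Function.comp_apply, AddMonoid.End.coe_pow, AddMonoid.End.coe_pow] at h
  have h' := congrArg Additive.toMul h
  rw [toMul_sub, toMul_ofMul, div_eq_mul_inv, toMul_add, toMul_add, toMul_sub, toMul_sub, toMul_nsmul,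
    div_eq_mul_inv, div_eq_mul_inv] at h'
  have e₁ : ∀ (k : ℕ) (x : Additive U), Additive.toMul ((⇑δ₁)^[k] x) = (⇑γ₁)^[k] (Additive.toMul x) := by
    intro k
    induction k with
    | zero => intro x; rfl
    | succ k ih => intro x; rw [Function.iterate_succ_apply', Function.iterate_succ_apply', ← ih]; rfl
  have e₂ : ∀ (k : ℕ) (x : Additive U), Additive.toMul ((⇑δ₂)^[k] x) = (⇑γ₂)^[k] (Additive.toMul x) := by
    intro k
    induction k with
    | zero => intro x; rfl
    | succ k ih => intro x; rw [Function.iterate_succ_apply', Function.iterate_succ_apply', ← ih]; rfl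
  rw [e₁, e₂, toMul_ofMul] at h'
  exact h'

/-- **Covers assemble over blocks** (multiplicative form of `exists_cover_of_blocks`, delivering the `P` of `hP`): if `U` is
generated by finitely many subgroups `N o` and each `N o` is covered modulo the relations by a finite set `S o`, then there is
`P ≤ U` of finite index `≤ ∏_o #(S o)` consisting of relations. [folklore] -/
theorem exists_subgroup_of_block_covers {O : Type*} [Fintype O] (N : O → Subgroup U)
    (hgen : ∀ u : U, ∃ f : O → U, (∀ o, f o ∈ N o) ∧ u = ∏ o, f o) (S : O → Finset U)
    (hS : ∀ o, ∀ n ∈ N o, ∃ s ∈ S o, ∃ a b d : U, n * s⁻¹ = a ^ p * (γ₁ b * b⁻¹) * (γ₂ d * d⁻¹)) :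
    ∃ P : Subgroup U, P.FiniteIndex ∧ P.index ≤ ∏ o, (S o).card ∧
      ∀ u ∈ P, ∃ a b d : U, u = a ^ p * (γ₁ b * b⁻¹) * (γ₂ d * d⁻¹) := by
  classical
  obtain ⟨P, hP⟩ := exists_subgroup_rel p γ₁ γ₂
  have hcover : ∀ u, ∃ t ∈ (Fintype.piFinset S).image (fun g ↦ ∏ o, g o), u * t⁻¹ ∈ P := by
    intro u
    obtain ⟨f, hf, rfl⟩ := hgen u
    choose g hgS hg using fun o ↦ hS o (f o) (hf o)
    refine ⟨∏ o, g o, Finset.mem_image.2 ⟨g, Fintype.mem_piFinset.2 hgS, rfl⟩, ?_⟩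
    rw [← Finset.prod_inv_distrib, ← Finset.prod_mul_distrib]
    exact prod_mem fun o _ ↦ (hP _).2 (hg o)
  obtain ⟨hfin, hidx⟩ := finiteIndex_and_index_le_of_mul_cover P _ hcover
  exact ⟨P, hfin, hidx.trans (Finset.card_image_le.trans (Fintype.card_piFinset S).le), fun u hu ↦ (hP u).1 hu⟩

/-- **Orbit transport** (multiplicative form of `cover_block_of_transport`): a block generated by subgroups `M x`, `x ∈ O`, in
which every `m ∈ M x` is a relation away from the fixed `M x₀` (in the application `m = h•m₀`, `h = γ₁^iγ₂^j`,
`rel_iterate_iterate_mul_inv`), is covered modulo the relations by any cover of `M x₀`. [folklore] -/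
theorem mul_cover_block_of_transport {X : Type*} (O : Finset X) (M : X → Subgroup U) (x₀ : X)
    (htr : ∀ x ∈ O, ∀ m ∈ M x, ∃ m₀ ∈ M x₀, ∃ a b d : U, m * m₀⁻¹ = a ^ p * (γ₁ b * b⁻¹) * (γ₂ d * d⁻¹))
    (S₀ : Finset U) (hS₀ : ∀ m ∈ M x₀, ∃ s ∈ S₀, ∃ a b d : U, m * s⁻¹ = a ^ p * (γ₁ b * b⁻¹) * (γ₂ d * d⁻¹))
    (n : U) (hn : ∃ f : X → U, (∀ x ∈ O, f x ∈ M x) ∧ n = ∏ x ∈ O, f x) :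
    ∃ s ∈ S₀, ∃ a b d : U, n * s⁻¹ = a ^ p * (γ₁ b * b⁻¹) * (γ₂ d * d⁻¹) := by
  classical
  obtain ⟨P, hP⟩ := exists_subgroup_rel p γ₁ γ₂
  obtain ⟨f, hf, rfl⟩ := hn
  have hch : ∀ x, ∃ m₀ : U, x ∈ O → m₀ ∈ M x₀ ∧ f x * m₀⁻¹ ∈ P := by
    intro x
    by_cases hx : x ∈ O
    · obtain ⟨m₀, hm₀, hrel⟩ := htr x hx (f x) (hf x hx)
      exact ⟨m₀, fun _ ↦ ⟨hm₀, (hP _).2 hrel⟩⟩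
    · exact ⟨1, fun h ↦ (hx h).elim⟩
  choose g hg using hch
  have hprod : ∏ x ∈ O, g x ∈ M x₀ := prod_mem fun x hx ↦ (hg x hx).1
  obtain ⟨s, hs, hrel⟩ := hS₀ _ hprod
  refine ⟨s, hs, (hP _).1 ?_⟩
  have e : (∏ x ∈ O, f x) * s⁻¹ = (∏ x ∈ O, f x * (g x)⁻¹) * ((∏ x ∈ O, g x) * s⁻¹) := by
    rw [Finset.prod_mul_distrib, Finset.prod_inv_distrib, mul_assoc, inv_mul_cancel_left]
  rw [e]
  exact P.mul_mem (prod_mem fun x hx ↦ (hg x hx).2) ((hP _).2 hrel)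

end Multiplicative

end Summit.BirchSwinnertonDyer.BirchSwinnertonDyer.Theorems.PrintCf2.UnitsFGLayerBound
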